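import Summits.BirchSwinnertonDyer.BirchSwinnertonDyer.Theorems.RamifiedHeegnerPairLeafRankOneUpperAtThreeTwistUnit
import HarnessLib

/-!
# Route `RamifiedHeegnerPair`, crux U₁ `LeafRankOneUpperAtThree` (stmt-BirchSwinnertonDyer-26022), line `splitkolyvagin` —
# the EXACT fourth stub: the PARTNER-LOWER supply PL₀ (U₁ ⟸ PUB⁺ ∧ S2 ∧ Σ★″ ∧ PL₀; PL₀ ⟸ L₀, PL₀ ⟸ TU₁, PL₀ ⟸ the leaf)

HONEST FRAMING. Theorems only; helper file (`--supports stmt-BirchSwinnertonDyer-26022`); nothing is booked, no item is closed, BSD is not proved for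
any curve; CONDITIONAL on every displayed input. Lead prover bsd-line-rhp-p2 g7, 2026-08-28; sequel of `…LeafRankOneUpperAtThreeTwistUnit.lean` (p630223).

WHY. The registered composition spends the route member L₀ (26023: the lower half at EVERY rank-zero leaf curve) and the twist-unit road spends TU₁
(a `3`-unit rank-zero twist — research with SURPLUS over the leaf); but what `missingUpperBoundAt_of_jointUpper_of_lower` actually consumes is the
lower half of ONE Heegner partner of the given rank-one curve. This file isolates that exact input — the PARTNER-LOWER supply
  PL₀(W) := ∃ K imaginary quadratic (odd `d_K`, Heegner for `N_W`, `L(W^{(d_K)},1) ≠ 0`) and a globally minimal model `Wd` of `W^{(d_K)}` with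
            `Typed.MissingLowerBoundAt Wd 3` (spelled inline)
and proves (ns `…Theorems.RamifiedPairUpperBound`):

* §1 `leafRankOneUpper_three_of_sigmaAtDatum_of_partnerLower` — U₁ AT `W` from Σ AT ONE DATUM over the PL₀ field (p610955 §1 with (Friedberg–Hoffstein,
  L₀) ↦ PL₀(W); no Cassels needed); §2 `leafRankOneUpper_three_tamFree_of_print_of_partnerLower` (tam-free rows: six printed facts + PL₀(W));
  §3 `…monoCarrier_of_divisibilityReading_of_partnerLower` (S2 by name + PL₀(W)); §4 `…latticeOptimal_…_of_sigmaStar_of_partnerLower` (S2 + Σ★″ by name).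
* §5 `leafRankOneUpperAtThree_of_pubManin_of_divisibilityReading_of_sigmaStar_of_partnerLower : LeafRankOnePrintedInputsAtThree → JetchevDivisibilityReadingS2
  → LeafSigmaStarDivisibilityAtThreeOptimalOffRows → PL₀ → LeafRankOneUpperAtThree` and `leafRankOneUpperAtThreeGlue_of_partnerLower : PL₀ → LeafRankOneUpperAtThreeGlue`
  (PL₀ := ∀ non-CM leaf `W` of analytic rank one, PL₀(W)).
* §6 THE THREE SOURCES of PL₀ — `partnerLower_of_lowerRankZero` (⟸ L₀ 26023 with the Friedberg–Hoffstein field, print: the twist is a rank-zero LEAF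
  curve, `leaf_twist_of_heegner`), `partnerLower_of_twistUnit` (⟸ `SchneiderFree.Upper.TwistUnitFieldAt W 3`, i.e. TU₁ at `W`, by Cassels + GZK + Version
  L), and `partnerLower_of_wAllExclAddGssAtThree` (⟸ the LEAF `WAllExclAddGssAtThree` itself + Friedberg–Hoffstein + GZK: `BSD₃` of the twist gives its
  lower half) — so PL₀ is TIGHT (no surplus over the leaf, unlike TU₁) and WEAKER than both L₀ and TU₁ (the pen's criterion (ii) of 11:33:57Z).

NET (mod print): U₁ ⟸ S2 ∧ Σ★″ ∧ PL₀, PL₀ ⟸ L₀, PL₀ ⟸ TU₁, PL₀ ⟸ leaf. PL₀ is research as a ∀-statement (it is one rank-zero lower half per rank-one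
curve), decidable per class by EITHER certificate (a unit twist by modular symbols, p632827; or a `3`-descent on a twist exhibiting `ord₃ #Ш ≥ ord₃ #Ш_an`).
BSD is not proved; U₁ / L₀ / TU₁ / PL₀ are OPEN. References: [cite: FriedbergHoffstein1995, Thm. B] [cite: MilneADT2006, Thm. I.7.3 and Remark I.7.4]
[cite: Miller2011LMS, §1 and Def. 1.1] [cite: GrossZagier1986, Thm. I.(6.3) and (7.3)] [cite: MatarNekovar2019, Thm. 0.7 (p. 456) and §0.11 (p. 457)]
[cite: Jetchev2008, Conj. 1.3, Thm. 1.4, Cor. 1.5 (p. 812)] [cite: Mazur1978, Cor. 4.1] [cite: KrizLi2019, Thm. 1.20].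
-/

-- D-0017: single-problem summit, so `Summit.BirchSwinnertonDyer.BirchSwinnertonDyer.…` repeats a namespace BY DESIGN.
set_option linter.dupNamespace false
set_option autoImplicit false

noncomputable section

open scoped Classical NumberField

open WeierstrassCurve IsDedekindDomain IsDedekindDomain.HeightOneSpectrum NumberField
  Rat.HeightOneSpectrum Literature Literature.NumberTheory.EllipticCurves
  Literature.NumberTheory.EllipticCurves.ModularForms
  Literature.NumberTheory.EllipticCurves.Rank1Residual
  Literature.NumberTheory.EllipticCurves.Rank1Residual.Typed
  Literature.NumberTheory.EllipticCurves.KrizLi2019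
  Literature.NumberTheory.QuadraticFields
  Summit.BirchSwinnertonDyer.Rank1Residual
  Summit.BirchSwinnertonDyer.Rank1Residual.Additive
  Summit.BirchSwinnertonDyer.Rank1Residual.X11b.Three
  Summit.BirchSwinnertonDyer.BirchSwinnertonDyer.Theses.RamifiedHeegnerPair
  Summit.BirchSwinnertonDyer.BirchSwinnertonDyer.Theorems
  Summit.BirchSwinnertonDyer.BirchSwinnertonDyer.Theorems.SchneiderFree

namespace Summit.BirchSwinnertonDyer.BirchSwinnertonDyer.Theorems.RamifiedPairUpperBound

/-! ## §1 One datum: U₁ at `W` from Σ at the datum over the PARTNER-LOWER field -/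

/-- **U₁ AT `W` from Σ AT ONE PARAMETRISATION DATUM over the partner-lower field.** For a non-CM leaf `W` (`Addv W 3`, `SubGss W 3`) of analytic rank
one, a parametrisation datum `Dt` at level `N_E`, and PL₀(W) (`hPL`: a Heegner field `K` of odd discriminant with `L(W^{(d_K)},1) ≠ 0` and a globally
minimal model `Wd` of the twist carrying its LOWER half `Typed.MissingLowerBoundAt Wd 3`): IF Σ holds at `Dt` (`hSig`), THEN `Typed.MissingUpperBoundAt W 3`
— given the printed facts `hGZ hKo hGZK hmod hGZ73 hMN`. The receptacle is p607279's `leafRankOneUpper_three_of_globalDivisibility_of_twistLower`,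
fed with PL₀'s own field and model. CONDITIONAL on every displayed input; nothing asserted. [cite: GrossZagier1986, Thm. I.(6.3) and (7.3)]
[cite: MatarNekovar2019, Thm. 0.7 (p. 456)] [cite: Jetchev2008, Conj. 1.3 (p. 812)] [cite: Miller2011LMS, Def. 1.1] -/
theorem leafRankOneUpper_three_of_sigmaAtDatum_of_partnerLower
    (hGZ : ∀ (N : ℕ) [NeZero N] (W : WeierstrassCurve ℚ) (K : Type) [Field K] [NumberField K],
      gross_zagier N W K)
    (hKo : ∀ (N : ℕ) [NeZero N] (W : WeierstrassCurve ℚ) (K : Type) [Field K] [NumberField K],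
      kolyvagin N W K)
    (hGZK : rank_eq_analyticRank_of_analyticRank_le_one) (hmod : hasEntireLFunction_rat)
    (hGZ73 : GrossZagier1986_thm_I_7_3)
    (hMN : MatarNekovar2019.thm07_padicValNat_card_sha_primary_add_le_of_globalDivisibility_of_irreducible)
    (W : WeierstrassCurve ℚ) [W.IsElliptic] [W.IsGloballyMinimal] [NeZero (W.conductorNorm ℤ)]
    (hCM : ¬ W.HasCM) (hadd : Addv W 3) (hsub : SubGss W 3) (hr : W.analyticRank = 1)
    (Dt : ModularParametrizationData W (W.conductorNorm ℤ))
    (hPL : ∃ (K : Type) (_ : Field K) (_ : NumberField K) (Wd : WeierstrassCurve ℚ) (_ : Wd.IsElliptic) (_ : Wd.IsGloballyMinimal),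
      IsImaginaryQuadratic K ∧ Odd (NumberField.discr K) ∧ SatisfiesHeegnerHypothesis (W.conductorNorm ℤ) K ∧
      (W.quadraticTwist (NumberField.discr K : ℚ)).entireLFunction 1 ≠ 0 ∧
      (∃ C : VariableChange ℚ, C • W.quadraticTwist (NumberField.discr K : ℚ) = Wd) ∧ MissingLowerBoundAt Wd 3)
    (hSig : ∀ (K : Type) [Field K] [NumberField K]
      (H : HeegnerDatum (W.conductorNorm ℤ) (NumberField.discr K)) (ι : K →+* ℂ) (P : (W.baseChange K).toAffine.Point),
      IsImaginaryQuadratic K → SatisfiesHeegnerHypothesis (W.conductorNorm ℤ) K →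
      (W.quadraticTwist (NumberField.discr K : ℚ)).entireLFunction 1 ≠ 0 →
      WeierstrassCurve.Affine.Point.map ι.toRatAlgHom P = heegnerPointComplex Dt H → ¬ IsOfFinAddOrder P →
      Odd (NumberField.discr K) →
      ∀ (s' : ℕ), s' ≤ padicValNat 3 W.tamagawaProduct + padicValNat 3 Dt.c.natAbs →
      ∀ (n : ℕ) (d : KolyvaginHeegnerData Dt H.β ι n), Squarefree n →
      (∀ ℓ ∈ n.primeFactors, Zhang2014.IsKolyvaginPrime (W.conductorNorm ℤ) W K 3 ℓ ∧
        s' ≤ Zhang2014.kolyvaginIndex W 3 ℓ) → Koly.PDiv d 3 s') :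
    MissingUpperBoundAt W 3 := by
  obtain ⟨K, _, _, Wd, _, _, hK, hodd, hHN, hLt, hC, hlow⟩ := hPL
  -- the Heegner datum and the `K`-rational Heegner point of `Dt`
  obtain ⟨β, hβ⟩ := exists_dvd_sq_sub_discr_holds (W.conductorNorm ℤ) K hK hHN
  obtain ⟨H, -⟩ := nonempty_heegnerDatum_holds (W.conductorNorm ℤ) K hK hβ
  obtain ⟨ι⟩ : Nonempty (K →+* ℂ) := inferInstance
  obtain ⟨P, hP⟩ := heegnerPointComplex_mem_range_map_holds (W.conductorNorm ℤ) W K hK hHN Dt H ι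
  -- the Heegner point is non-torsion (Gross–Zagier: `L′(E/K,1) = L′(E,1)·L(E^{(d_K)},1) ≠ 0`)
  have hL0W : W.entireLFunction 1 = 0 := entireLFunction_one_eq_zero_of_analyticRank_eq_one hr
  obtain ⟨-, hderiv⟩ := leadingLCoeff_eq_deriv_of_analyticRank_eq_one hr
  have hLK : LDerivEK W K ≠ 0 := by
    rw [lDerivEK_eq_deriv_mul W K hmod hL0W]; exact mul_ne_zero hderiv hLt
  have hnt : ¬ IsOfFinAddOrder P :=
    (lDerivEK_ne_zero_iff_not_isOfFinAddOrder W (W.conductorNorm ℤ) K (hGZ _ W K) hK hHN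
      ⟨Dt, H, ι, hP⟩).mp hLK
  exact leafRankOneUpper_three_of_globalDivisibility_of_twistLower hGZ hKo hGZK hmod hGZ73 hMN W hCM hadd hsub hr
    K Dt H ι P Wd hK hodd hHN hLt hP hC (fun s' hs' n d hn hℓ ↦ hSig K H ι P hK hHN hLt hP hnt hodd s' hs' n d hn hℓ) hlow

/-! ## §2 The Tamagawa-free rows: U₁ ⟸ six printed facts + PL₀(W) -/

/-- **U₁ on the TAMAGAWA-FREE rows from PRINT + PL₀(W) ALONE** (`3 ∤ ∏_ℓ c_ℓ(W)`, a parametrisation datum at level `N_E` with `3 ∤ c`): the depth of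
Σ is `0`. Weaker hypotheses than both p610955 §3 (L₀) and p630223 §3 (TU₁). [cite: MatarNekovar2019, Thm. 0.7 (p. 456) and §0.11 (p. 457)]
[cite: GrossZagier1986, Thm. I.(6.3) and (7.3)] [cite: Miller2011LMS, Def. 1.1] -/
theorem leafRankOneUpper_three_tamFree_of_print_of_partnerLower
    (hGZ : ∀ (N : ℕ) [NeZero N] (W : WeierstrassCurve ℚ) (K : Type) [Field K] [NumberField K],
      gross_zagier N W K)
    (hKo : ∀ (N : ℕ) [NeZero N] (W : WeierstrassCurve ℚ) (K : Type) [Field K] [NumberField K],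
      kolyvagin N W K)
    (hGZK : rank_eq_analyticRank_of_analyticRank_le_one) (hmod : hasEntireLFunction_rat)
    (hGZ73 : GrossZagier1986_thm_I_7_3)
    (hMN : MatarNekovar2019.thm07_padicValNat_card_sha_primary_add_le_of_globalDivisibility_of_irreducible)
    (W : WeierstrassCurve ℚ) [W.IsElliptic] [W.IsGloballyMinimal] [NeZero (W.conductorNorm ℤ)]
    (hCM : ¬ W.HasCM) (hadd : Addv W 3) (hsub : SubGss W 3) (hr : W.analyticRank = 1)
    (htam : ¬ 3 ∣ W.tamagawaProduct)
    (Dt : ModularParametrizationData W (W.conductorNorm ℤ)) (hc : ¬ (3 : ℤ) ∣ Dt.c)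
    (hPL : ∃ (K : Type) (_ : Field K) (_ : NumberField K) (Wd : WeierstrassCurve ℚ) (_ : Wd.IsElliptic) (_ : Wd.IsGloballyMinimal),
      IsImaginaryQuadratic K ∧ Odd (NumberField.discr K) ∧ SatisfiesHeegnerHypothesis (W.conductorNorm ℤ) K ∧
      (W.quadraticTwist (NumberField.discr K : ℚ)).entireLFunction 1 ≠ 0 ∧
      (∃ C : VariableChange ℚ, C • W.quadraticTwist (NumberField.discr K : ℚ) = Wd) ∧ MissingLowerBoundAt Wd 3) :
    MissingUpperBoundAt W 3 := by
  have ht0 : padicValNat 3 W.tamagawaProduct = 0 := padicValNat.eq_zero_of_not_dvd htam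
  have hc0 : padicValNat 3 Dt.c.natAbs = 0 :=
    padicValNat.eq_zero_of_not_dvd fun h ↦ hc (Int.ofNat_dvd_left.mpr h)
  refine leafRankOneUpper_three_of_sigmaAtDatum_of_partnerLower hGZ hKo hGZK hmod hGZ73 hMN W hCM hadd hsub hr Dt hPL ?_
  intro K _ _ H ι P _ _ _ _ _ _ s' hs' n d _ _
  have hs0 : s' = 0 := by omega
  subst hs0
  exact koly_pDiv_zero d 3

/-! ## §3 The mono-multiplicative-carrier rows: U₁ ⟸ print + S2 + PL₀(W) -/

/-- **U₁ AT `W` ON A MONO-MULTIPLICATIVE-CARRIER ROW WITH A MANIN-CLEAN DATUM, from S2 (item 27492 BY NAME) and PL₀(W).** As p615347 §2 / p630223 §4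
with the partner supplied by PL₀. CONDITIONAL; nothing asserted. [cite: Jetchev2008, Thm. 1.4 and Cor. 1.5 (p. 812)] [cite: MatarNekovar2019, Thm. 0.7 (p. 456)]
[cite: GrossZagier1986, Thm. I.(6.3) and (7.3)] [cite: Miller2011LMS, Def. 1.1] -/
theorem leafRankOneUpper_three_monoCarrier_of_divisibilityReading_of_partnerLower
    (hGZ : ∀ (N : ℕ) [NeZero N] (W : WeierstrassCurve ℚ) (K : Type) [Field K] [NumberField K],
      gross_zagier N W K)
    (hKo : ∀ (N : ℕ) [NeZero N] (W : WeierstrassCurve ℚ) (K : Type) [Field K] [NumberField K],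
      kolyvagin N W K)
    (hGZK : rank_eq_analyticRank_of_analyticRank_le_one) (hmod : hasEntireLFunction_rat)
    (hGZ73 : GrossZagier1986_thm_I_7_3)
    (hMN : MatarNekovar2019.thm07_padicValNat_card_sha_primary_add_le_of_globalDivisibility_of_irreducible)
    (hD : JetchevDivisibilityReadingS2)
    (W : WeierstrassCurve ℚ) [W.IsElliptic] [W.IsGloballyMinimal] [NeZero (W.conductorNorm ℤ)]
    (hCM : ¬ W.HasCM) (hadd : Addv W 3) (hsub : SubGss W 3) (hr : W.analyticRank = 1)
    (q : ℕ) [Fact q.Prime] (hqN : q ∣ W.conductorNorm ℤ) (hq2 : ¬ q ^ 2 ∣ W.conductorNorm ℤ)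
    (hmono : padicValNat 3 W.tamagawaProduct ≤ padicValNat 3 ((W.baseChange ℚ_[q]).localTamagawaNumber ℤ_[q]))
    (htam : ∀ (q' : ℕ) [Fact q'.Prime], q' ∣ W.conductorNorm ℤ →
      3 ∣ (W.baseChange ℚ_[q']).localTamagawaNumber ℤ_[q'] → ¬ q' ^ 2 ∣ W.conductorNorm ℤ)
    (Dt : ModularParametrizationData W (W.conductorNorm ℤ)) (hc : ¬ (3 : ℤ) ∣ Dt.c)
    (hPL : ∃ (K : Type) (_ : Field K) (_ : NumberField K) (Wd : WeierstrassCurve ℚ) (_ : Wd.IsElliptic) (_ : Wd.IsGloballyMinimal),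
      IsImaginaryQuadratic K ∧ Odd (NumberField.discr K) ∧ SatisfiesHeegnerHypothesis (W.conductorNorm ℤ) K ∧
      (W.quadraticTwist (NumberField.discr K : ℚ)).entireLFunction 1 ≠ 0 ∧
      (∃ C : VariableChange ℚ, C • W.quadraticTwist (NumberField.discr K : ℚ) = Wd) ∧ MissingLowerBoundAt Wd 3) :
    MissingUpperBoundAt W 3 := by
  have hirr : W.HasIrreducibleModPGaloisRep 3 := (classX4_three_of_addv_of_subGss W hadd hsub).2.2
  have hj : 0 ≤ padicValRat 3 W.j := padicValRat_j_nonneg_of_subGss_three W hadd hsub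
  have hc3 : ¬ 3 ∣ (W.baseChange ℚ_[3]).localTamagawaNumber ℤ_[3] :=
    not_three_dvd_localTamagawaNumber_three_of_subGss W hadd hsub
  have h3N : 3 ∣ W.conductorNorm ℤ :=
    (W.dvd_conductorNorm_iff_not_hasGoodReductionAtPrime 3).mpr (not_good_of_addv W 3 hadd)
  refine leafRankOneUpper_three_of_sigmaAtDatum_of_partnerLower hGZ hKo hGZK hmod hGZ73 hMN W hCM hadd hsub hr Dt hPL ?_
  intro K _ _ H ι P hK hHN hLt hP hnt hodd s' hs' n d hn hℓ
  rcases Nat.eq_zero_or_pos s' with hs0 | hspos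
  · subst hs0
    exact koly_pDiv_zero d 3
  have hc0 : padicValNat 3 Dt.c.natAbs = 0 :=
    padicValNat.eq_zero_of_not_dvd fun h ↦ hc (Int.ofNat_dvd_left.mpr h)
  have hsq : s' ≤ padicValNat 3 ((W.baseChange ℚ_[q]).localTamagawaNumber ℤ_[q]) := by omega
  have hq3 : q ≠ 3 := by
    rintro rfl
    have hpos : 0 < padicValNat 3 ((W.baseChange ℚ_[3]).localTamagawaNumber ℤ_[3]) := by omega
    exact hc3 (dvd_of_one_le_padicValNat hpos)
  have h3 : NumberField.discr K ≠ -3 := by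
    intro h
    exact (X11b.Three.not_dvd_discr_and_not_dvd_torsionOrder_of_heegner hK hHN (by decide) h3N).1
      (h ▸ ⟨-1, by norm_num⟩)
  have h4 : NumberField.discr K ≠ -4 := by
    intro h
    rw [h] at hodd
    exact (Int.not_odd_iff_even.mpr ⟨-2, by norm_num⟩) hodd
  obtain ⟨d₁⟩ := exists_kolyvaginHeegnerData_one
    (phi_heegnerTau_mem_singularModuliField_holds (W.conductorNorm ℤ) W K) hK Dt H.β ι H.dvd_sq_sub
  have hPd : d₁.toGeomPoints d₁.derivedPoint = toGeomPoints (W.baseChange K) P :=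
    X11b.KolyvaginBottom.toGeomPoints_derivedPoint_one_eq
      (heegnerPointOfConductor_one_galoisConj_holds (W.conductorNorm ℤ) W K) hK hHN hP d₁ rfl
  have hy₁ : ¬ IsOfFinAddOrder d₁.derivedPoint := by
    intro hfin
    apply hnt
    have h1 : IsOfFinAddOrder (d₁.toGeomPoints d₁.derivedPoint) := d₁.toGeomPoints.isOfFinAddOrder hfin
    rw [hPd] at h1
    exact (toGeomPoints_injective (W.baseChange K)).isOfFinAddOrder_iff.mp h1
  exact hD W hCM K hK h3 h4 hHN 3 (by decide) hadd hj hirr hc3 htam Dt H.β ι d₁ hy₁ q hqN hq2 hq3 s' hsq n d hn hℓ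

/-! ## §4 At a lattice-optimal member: U₁ ⟸ print⁺ + S2 + Σ★″ + PL₀(W) -/

/-- **U₁ AT A LEAF CURVE CARRYING A LATTICE-OPTIMAL DATUM ⟸ print⁺ + S2 (27492) + Σ★″ (27493) + PL₀(W).** Case split on the mono-multiplicative-carrier
row predicate as p621612 §4 / p630223 §5; the Manin clause from the three printed Manin facts + newform. CONDITIONAL; nothing asserted.
[cite: Jetchev2008, Conj. 1.3, Thm. 1.4 (p. 812)] [cite: MatarNekovar2019, Thm. 0.7 (p. 456)] [cite: Mazur1978, Cor. 4.1] [cite: Miller2011LMS, Def. 1.1] -/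
theorem leafRankOneUpper_three_of_latticeOptimal_of_divisibilityReading_of_sigmaStar_of_partnerLower
    (hGZ : ∀ (N : ℕ) [NeZero N] (W : WeierstrassCurve ℚ) (K : Type) [Field K] [NumberField K],
      gross_zagier N W K)
    (hKo : ∀ (N : ℕ) [NeZero N] (W : WeierstrassCurve ℚ) (K : Type) [Field K] [NumberField K],
      kolyvagin N W K)
    (hGZK : rank_eq_analyticRank_of_analyticRank_le_one) (hmod : hasEntireLFunction_rat)
    (hGZ73 : GrossZagier1986_thm_I_7_3)
    (hMN : MatarNekovar2019.thm07_padicValNat_card_sha_primary_add_le_of_globalDivisibility_of_irreducible)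
    (hnf : exists_isNewformOf)
    (hM : mazur_not_dvd_maninConstant_of_odd) (hAU : abbesUllmo_not_dvd_maninConstant_of_not_dvd_level)
    (hC2 : cesnavicius_not_two_dvd_maninConstant_of_two_dvd_level)
    (hD : JetchevDivisibilityReadingS2) (hStar : LeafSigmaStarDivisibilityAtThreeOptimalOffRows)
    (W : WeierstrassCurve ℚ) [W.IsElliptic] [W.IsGloballyMinimal] [NeZero (W.conductorNorm ℤ)]
    (hCM : ¬ W.HasCM) (hadd : Addv W 3) (hsub : SubGss W 3) (hr : W.analyticRank = 1)
    (Dt : ModularParametrizationData W (W.conductorNorm ℤ))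
    (hopt : ∀ z ∈ Dt.L.lattice, ∃ w ∈ periodLattice Dt.f, z = Dt.c * w)
    (hPL : ∃ (K : Type) (_ : Field K) (_ : NumberField K) (Wd : WeierstrassCurve ℚ) (_ : Wd.IsElliptic) (_ : Wd.IsGloballyMinimal),
      IsImaginaryQuadratic K ∧ Odd (NumberField.discr K) ∧ SatisfiesHeegnerHypothesis (W.conductorNorm ℤ) K ∧
      (W.quadraticTwist (NumberField.discr K : ℚ)).entireLFunction 1 ≠ 0 ∧
      (∃ C : VariableChange ℚ, C • W.quadraticTwist (NumberField.discr K : ℚ) = Wd) ∧ MissingLowerBoundAt Wd 3) :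
    MissingUpperBoundAt W 3 := by
  by_cases hrow : ((∃ (q : ℕ) (_ : Fact q.Prime), q ∣ W.conductorNorm ℤ ∧ ¬ q ^ 2 ∣ W.conductorNorm ℤ ∧
          padicValNat 3 W.tamagawaProduct ≤ padicValNat 3 ((W.baseChange ℚ_[q]).localTamagawaNumber ℤ_[q])) ∧
        (∀ (q' : ℕ) [Fact q'.Prime], q' ∣ W.conductorNorm ℤ →
          3 ∣ (W.baseChange ℚ_[q']).localTamagawaNumber ℤ_[q'] → ¬ q' ^ 2 ∣ W.conductorNorm ℤ))
  · obtain ⟨⟨q, _, hqN, hq2, hmono⟩, htam⟩ := hrow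
    exact leafRankOneUpper_three_monoCarrier_of_divisibilityReading_of_partnerLower hGZ hKo hGZK hmod hGZ73 hMN hD W hCM hadd hsub
      hr q hqN hq2 hmono htam Dt (not_three_dvd_c_of_latticeOptimal_of_subGss hM hAU hC2 hnf W Dt hopt hadd hsub) hPL
  · exact leafRankOneUpper_three_of_sigmaAtDatum_of_partnerLower hGZ hKo hGZK hmod hGZ73 hMN W hCM hadd hsub hr Dt hPL
      (fun K _ _ H ι P hK hHN hLt hP hnt hodd s' hs' n d hn hℓ ↦
        sigmaOptOffRows_of_sigmaStarOptOffRows hStar W (W.conductorNorm ℤ) K Dt H ι P hCM hadd hsub hr rfl hopt hrow hK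
          hHN hLt hP hnt hodd s' hs' n d hn hℓ)

/-! ## §5 The class statement BY NAME: `LeafRankOneUpperAtThree` ⟸ PUB⁺ ∧ S2 ∧ Σ★″ ∧ PL₀, and the glue G₁ modulo PL₀ -/

/-- **`LeafRankOneUpperAtThree` (item 26022) BY NAME ⟸ PUB⁺ (27491) ∧ S2 (27492) ∧ Σ★″ (27493) ∧ PL₀**, PL₀ := every non-CM leaf curve of analytic
rank one has a Heegner partner of analytic rank zero carrying its lower half (spelled inline). Optimal member `W₀ ∼ W` (modularity alone; PL₀ applies AT
`W₀`), §4 there, Cassels + GZK + Version L back. Of PUB⁺ the Friedberg–Hoffstein and parametrisation-existence conjuncts are idle. CONDITIONAL; U₁ stays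
OPEN; BSD is not proved. [cite: Jetchev2008, Conj. 1.3, Thm. 1.4 (p. 812)] [cite: MatarNekovar2019, Thm. 0.7 (p. 456)] [cite: Mazur1978, Cor. 4.1]
[cite: MilneADT2006, Thm. I.7.3] [cite: Miller2011LMS, Def. 1.1] -/
theorem leafRankOneUpperAtThree_of_pubManin_of_divisibilityReading_of_sigmaStar_of_partnerLower
    (hpub : LeafRankOnePrintedInputsAtThree) (hD : JetchevDivisibilityReadingS2)
    (hStar : LeafSigmaStarDivisibilityAtThreeOptimalOffRows)
    (hPL : ∀ (W : WeierstrassCurve ℚ) [W.IsElliptic] [W.IsGloballyMinimal], ¬ W.HasCM →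
      Literature.NumberTheory.EllipticCurves.Rank1Residual.Addv W 3 →
      Summit.BirchSwinnertonDyer.Rank1Residual.Additive.SubGss W 3 → W.analyticRank = 1 →
      ∃ (K : Type) (_ : Field K) (_ : NumberField K) (Wd : WeierstrassCurve ℚ) (_ : Wd.IsElliptic) (_ : Wd.IsGloballyMinimal),
        IsImaginaryQuadratic K ∧ Odd (NumberField.discr K) ∧ SatisfiesHeegnerHypothesis (W.conductorNorm ℤ) K ∧
        (W.quadraticTwist (NumberField.discr K : ℚ)).entireLFunction 1 ≠ 0 ∧
        (∃ C : VariableChange ℚ, C • W.quadraticTwist (NumberField.discr K : ℚ) = Wd) ∧ MissingLowerBoundAt Wd 3) :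
    LeafRankOneUpperAtThree := by
  intro W _ _ hCM hadd hsub hr
  obtain ⟨hGZ, hKo, hGZK, hmod, hGZ73, hMN, hnf, -, -, hCassels, hM, hAU, hC2⟩ := hpub
  obtain ⟨W₀, hW₀, hW₀', N, hN0, D₀, hiso, hN₀, -, hopt, hCM₀, hadd₀, hsub₀, hr₀⟩ :=
    exists_optimal_leaf_member hnf W hCM hadd hsub
  haveI := hW₀
  haveI := hW₀'
  haveI := hN0
  have h₀ : MissingUpperBoundAt W₀ 3 := by
    subst hN₀
    exact leafRankOneUpper_three_of_latticeOptimal_of_divisibilityReading_of_sigmaStar_of_partnerLower hGZ hKo hGZK hmod hGZ73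
      hMN hnf hM hAU hC2 hD hStar W₀ hCM₀ hadd₀ hsub₀ (hr₀.trans hr) D₀ hopt (hPL W₀ hCM₀ hadd₀ hsub₀ (hr₀.trans hr))
  exact missingUpperBoundAt_of_isIsogenous_of_analyticRank_le_one hCassels hGZK hmod (le_of_eq hr) hiso h₀

/-- **G₁ modulo PL₀**: the generated glue `LeafRankOneUpperAtThreeGlue` (PUB⁺ → S2 → Σ★″ → U₁, item 27494) from the partner-lower supply PL₀ — the
common weakening of p626516's `…_of_lowerRankZero` and p630223's `…_of_twistUnit` (§6). CONDITIONAL on PL₀; closes nothing.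
[cite: Jetchev2008, Conj. 1.3 (p. 812)] [cite: MatarNekovar2019, Thm. 0.7 (p. 456)] [cite: Miller2011LMS, Def. 1.1] -/
theorem leafRankOneUpperAtThreeGlue_of_partnerLower
    (hPL : ∀ (W : WeierstrassCurve ℚ) [W.IsElliptic] [W.IsGloballyMinimal], ¬ W.HasCM →
      Literature.NumberTheory.EllipticCurves.Rank1Residual.Addv W 3 →
      Summit.BirchSwinnertonDyer.Rank1Residual.Additive.SubGss W 3 → W.analyticRank = 1 →
      ∃ (K : Type) (_ : Field K) (_ : NumberField K) (Wd : WeierstrassCurve ℚ) (_ : Wd.IsElliptic) (_ : Wd.IsGloballyMinimal),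
        IsImaginaryQuadratic K ∧ Odd (NumberField.discr K) ∧ SatisfiesHeegnerHypothesis (W.conductorNorm ℤ) K ∧
        (W.quadraticTwist (NumberField.discr K : ℚ)).entireLFunction 1 ≠ 0 ∧
        (∃ C : VariableChange ℚ, C • W.quadraticTwist (NumberField.discr K : ℚ) = Wd) ∧ MissingLowerBoundAt Wd 3) :
    LeafRankOneUpperAtThreeGlue :=
  fun hP hS hSig ↦ leafRankOneUpperAtThree_of_pubManin_of_divisibilityReading_of_sigmaStar_of_partnerLower hP hS hSig hPL

/-! ## §6 The three sources of PL₀: L₀ (route member), TU₁ (twist unit), and the leaf itself (tightness) -/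

/-- **PL₀ ⟸ L₀** (the registered road's input): with the Friedberg–Hoffstein field (`2` and every `ℓ ∣ N_E` split, `L(E^{(d)},1) ≠ 0`; root number `−1`
by modularity `hnf`) the minimal twist is a non-CM rank-zero LEAF curve (`leaf_twist_of_heegner`), so the route member L₀ = `Gss2LowerAtThreeRankZero` pays
its lower half. [cite: FriedbergHoffstein1995, Thm. B] [cite: Miller2011LMS, Def. 1.1] -/
theorem partnerLower_of_lowerRankZero (hnf : exists_isNewformOf)
    (hFH : friedbergHoffstein_exists_heegnerField_splitDivisors_twist_ne_zero) (hL0 : Gss2LowerAtThreeRankZero)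
    (W : WeierstrassCurve ℚ) [W.IsElliptic] [W.IsGloballyMinimal] (hCM : ¬ W.HasCM) (hadd : Addv W 3) (hsub : SubGss W 3)
    (hr : W.analyticRank = 1) :
    ∃ (K : Type) (_ : Field K) (_ : NumberField K) (Wd : WeierstrassCurve ℚ) (_ : Wd.IsElliptic) (_ : Wd.IsGloballyMinimal),
      IsImaginaryQuadratic K ∧ Odd (NumberField.discr K) ∧ SatisfiesHeegnerHypothesis (W.conductorNorm ℤ) K ∧
      (W.quadraticTwist (NumberField.discr K : ℚ)).entireLFunction 1 ≠ 0 ∧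
      (∃ C : VariableChange ℚ, C • W.quadraticTwist (NumberField.discr K : ℚ) = Wd) ∧ MissingLowerBoundAt Wd 3 := by
  have hw : W.rootNumber = -1 := by
    rw [WeierstrassCurve.rootNumber_eq_neg_one_pow_analyticRank_of_exists_isNewformOf hnf W, hr]
    norm_num
  obtain ⟨K, _, _, hK, -, hHN, hH2, hLt⟩ := hFH W hw 2 two_ne_zero 4
  have hodd : Odd (NumberField.discr K) := by
    have h2 : ¬ ((2 : ℕ) : ℤ) ∣ NumberField.discr K :=
      Literature.SatisfiesHeegnerHypothesis.not_dvd_discr hK.1 hH2 Nat.prime_two (dvd_refl 2)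
    rw [← Int.not_even_iff_odd, even_iff_two_dvd]
    exact_mod_cast h2
  have hD0 : (NumberField.discr K : ℚ) ≠ 0 := by exact_mod_cast NumberField.discr_ne_zero K
  haveI hEt : (W.quadraticTwist (NumberField.discr K : ℚ)).IsElliptic := W.isElliptic_quadraticTwist hD0
  obtain ⟨Cd, hCd⟩ := hasGlobalMinimalModel_rat_holds (W.quadraticTwist (NumberField.discr K : ℚ))
  haveI : (Cd • W.quadraticTwist (NumberField.discr K : ℚ)).IsGloballyMinimal := hCd
  have hrd : (Cd • W.quadraticTwist (NumberField.discr K : ℚ)).analyticRank = 0 := by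
    rw [analyticRank_smul]
    exact analyticRank_eq_zero_of_entireLFunction_one_ne_zero _ hLt
  obtain ⟨hCMd, haddd, hsubd, -⟩ := leaf_twist_of_heegner W hCM hadd hsub K hK hHN hodd
    (Cd • W.quadraticTwist (NumberField.discr K : ℚ)) Cd rfl
  exact ⟨K, inferInstance, inferInstance, Cd • W.quadraticTwist (NumberField.discr K : ℚ), inferInstance, inferInstance, hK, hodd,
    hHN, hLt, ⟨Cd, rfl⟩, hL0 _ hCMd haddd hsubd hrd⟩

/-- **PL₀ ⟸ TU₁ at `W`** (the twist-unit road's input): the door's split twist-unit datum `SchneiderFree.Upper.TwistUnitFieldAt W 3` supplies the field,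
and the unit at the member's twist transports to the minimal model of `W^{(d_K)}` (p630223 §1, Cassels + GZK + Version L).
[cite: MilneADT2006, Thm. I.7.3 and Remark I.7.4] [cite: KrizLi2019, Thm. 1.20] [cite: Miller2011LMS, Def. 1.1] -/
theorem partnerLower_of_twistUnit (hCassels : bsdRHS_eq_of_isIsogenous)
    (hGZK : rank_eq_analyticRank_of_analyticRank_le_one) (hmod : hasEntireLFunction_rat)
    (W : WeierstrassCurve ℚ) [W.IsElliptic] [W.IsGloballyMinimal] (hTU : Upper.TwistUnitFieldAt W 3) :
    ∃ (K : Type) (_ : Field K) (_ : NumberField K) (Wd : WeierstrassCurve ℚ) (_ : Wd.IsElliptic) (_ : Wd.IsGloballyMinimal),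
      IsImaginaryQuadratic K ∧ Odd (NumberField.discr K) ∧ SatisfiesHeegnerHypothesis (W.conductorNorm ℤ) K ∧
      (W.quadraticTwist (NumberField.discr K : ℚ)).entireLFunction 1 ≠ 0 ∧
      (∃ C : VariableChange ℚ, C • W.quadraticTwist (NumberField.discr K : ℚ) = Wd) ∧ MissingLowerBoundAt Wd 3 := by
  obtain ⟨K, _, _, W₂, W₂d, _, _, _, _, hK, hodd, hHN, hLt, hiso, ⟨C, hC⟩, qd, hqd, hv⟩ := hTU
  have hD0 : (NumberField.discr K : ℚ) ≠ 0 := by exact_mod_cast NumberField.discr_ne_zero K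
  haveI hEt : (W.quadraticTwist (NumberField.discr K : ℚ)).IsElliptic := W.isElliptic_quadraticTwist hD0
  obtain ⟨Cd, hCd⟩ := hasGlobalMinimalModel_rat_holds (W.quadraticTwist (NumberField.discr K : ℚ))
  haveI : (Cd • W.quadraticTwist (NumberField.discr K : ℚ)).IsGloballyMinimal := hCd
  have hrd : (Cd • W.quadraticTwist (NumberField.discr K : ℚ)).analyticRank = 0 := by
    rw [analyticRank_smul]
    exact analyticRank_eq_zero_of_entireLFunction_one_ne_zero _ hLt
  exact ⟨K, inferInstance, inferInstance, Cd • W.quadraticTwist (NumberField.discr K : ℚ), inferInstance, inferInstance, hK, hodd,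
    hHN, hLt, ⟨Cd, rfl⟩, missingLowerBoundAt_twistModel_of_unitMember hCassels hGZK hmod hiso hD0 hC Cd (by omega) hqd hv⟩

/-- **PL₀ ⟸ the LEAF (tightness: no surplus).** From the rung leaf `WAllExclAddGssAtThree` itself (+ Friedberg–Hoffstein for the field, modularity for
the root number, GZK for finiteness): the minimal twist over the Friedberg–Hoffstein field is a rank-zero leaf curve, `BSD₃` holds for it by the leaf,
hence its lower half (`Typed.missingPPartAt_of_bsdp`). So PL₀ asks nothing beyond BSD₃ on the leaf — unlike TU₁. Nothing asserted (the leaf is a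
hypothesis). [cite: FriedbergHoffstein1995, Thm. B] [cite: Miller2011LMS, §1 and Def. 1.1] -/
theorem partnerLower_of_wAllExclAddGssAtThree (hnf : exists_isNewformOf)
    (hFH : friedbergHoffstein_exists_heegnerField_splitDivisors_twist_ne_zero)
    (hGZK : rank_eq_analyticRank_of_analyticRank_le_one)
    (hleaf : Summit.BirchSwinnertonDyer.WAllExclAddGssAtThree)
    (W : WeierstrassCurve ℚ) [W.IsElliptic] [W.IsGloballyMinimal] (hCM : ¬ W.HasCM) (hadd : Addv W 3) (hsub : SubGss W 3)
    (hr : W.analyticRank = 1) :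
    ∃ (K : Type) (_ : Field K) (_ : NumberField K) (Wd : WeierstrassCurve ℚ) (_ : Wd.IsElliptic) (_ : Wd.IsGloballyMinimal),
      IsImaginaryQuadratic K ∧ Odd (NumberField.discr K) ∧ SatisfiesHeegnerHypothesis (W.conductorNorm ℤ) K ∧
      (W.quadraticTwist (NumberField.discr K : ℚ)).entireLFunction 1 ≠ 0 ∧
      (∃ C : VariableChange ℚ, C • W.quadraticTwist (NumberField.discr K : ℚ) = Wd) ∧ MissingLowerBoundAt Wd 3 := by
  refine partnerLower_of_lowerRankZero hnf hFH ?_ W hCM hadd hsub hr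
  intro V _ _ hCMV haddV hsubV hrV
  have hbsd : BSDp V 3 := hleaf V hCMV haddV hsubV (by rw [hrV]; exact zero_le_one)
  haveI : Finite V.sha := (hGZK V (by rw [hrV]; exact zero_le_one)).2
  exact (Typed.lower_and_upper_of_missingPPartAt V 3 (Typed.missingPPartAt_of_bsdp V 3 hbsd)).1

end Summit.BirchSwinnertonDyer.BirchSwinnertonDyer.Theorems.RamifiedPairUpperBound

end
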